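import Summits.CriticalPhenomena.PercolationContinuityZ3.Theorems.PercNearOneGluingNoHeavyQuantThreeRootGateStep
import Summits.CriticalPhenomena.PercolationContinuityZ3.Theorems.PercNearOneGluingNoHeavyQuantThreeRootBlockMixture
import HarnessLib

/-!
# QUANT lane R8, T-DEC: THE THREE-SIBLING GATE STEP VIA THE BLOCK FAMILY, given nonnegative weights (census-2 g71, TIED3-G71 §0.4)

builds on p205010 (kernel theorem, internal audit signed; external expert review pending)

Support file (`--supports stmt-CriticalPhenomena-4575`), QUANT lane seat prim-quant-census-2 (gen 71).  Theorems only, standard axioms, no sorries.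
Sequel of `…QuantThreeRootGateStep` (`decAtT_of_oracle`, `exists_gate_of_treeBuiltN`) and `…QuantThreeRootBlockMixture` (`threeRootBlock_mixture`).

`decAt_threeRootBlock_of_oracle`: INSIDE the binder of the lead's node `LawDec.GateStepN` (gate budget `n`, oracle "every `TreeBuiltN` law with `< n`
nontrivial gates is SDEC"): opened trees `ρᵢ` tree-built at `x/p` with EQUAL opened means, tops `≥ 1`, `n₁+n₂+n₃+3 ≤ n`, a common root gate `x < p < 1`,
an outer gate `0 < a ≤ 1` with `3ap ≤ 2`, and NONNEGATIVE weights `wA wA2 wB wC wP` solving the four root-pattern equations (with `s = ap`, `r = 3s/2`):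
then `gate_a(gate_p ρ₁ ∗ gate_p ρ₂ ∗ gate_p ρ₃)` is DEC(j) at floor `a·x` at every layer `j < M₁+M₂+M₃`.  The components A (pair block re-gated to `r`,
third tree absent), A2 (two trees independently re-gated to `r`, third absent), B (`gate_s` of the opened triple), C (`gate_s ρᵢ ∗ gate_s(ρ_j∗ρ_k)`) are
oracle instances with fewer gates; P (`gate_s ρ₁ ∗ gate_s ρ₂ ∗ gate_s ρ₃`, as many gates as the forest) is the product of two oracle instances and is
DEC by `convClosedT_holds`; all have mean exactly `3sR` and floor `≥ a·x`; conclude with `decAtT_finite_mixture` (`decAtT_avg3` symmetrises).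
TIED3-G71 §0.4: nonnegative weights exist for EVERY `a ≤ min(1, 2/(3p))` and for no larger `a < 1` at pattern level; the explicit regimes and the
assembled theorem `sdec_threeRootBlock_of_le_twoThirds` (p ≤ 2/3: SDEC at every outer gate) are in `…QuantThreeRootBlockRegimes`.

HONEST STATUS.  `GateStepN`, `GateStepNCore`, `FarTreeRow` remain OPEN; this settles a sub-family of the open core given weights.  RATE class (log\*)
and the honest sentence of `run/shared/lean/prim/quant/README.md` unchanged.  [this work]; `GateStepN`/`TreeBuiltN`: lead g42; `ConvClosedT`: census-2
g60; SDEC: census-2 g53.  Nothing here is a published result.  The gluing rows served [cite: KozmaNitzan2024, Conjecture 3 (p. 15)]; product measure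
[cite: Grimmett1999, §1.3 p. 10].
-/

noncomputable section

namespace Summit.CriticalPhenomena.PercolationContinuityZ3.Theorems

namespace Quant

open Finset

namespace LawDec

/-- the average of three laws DEC at a common `(x, T, j′, M)` is DEC there. [this work] -/
theorem decAtT_avg3 {x T : ℝ} {j' M : ℕ} {μ₁ μ₂ μ₃ : ℕ → ℝ}
    (h₁ : DECAtT x T j' M μ₁) (h₂ : DECAtT x T j' M μ₂) (h₃ : DECAtT x T j' M μ₃) :
    DECAtT x T j' M (fun h => (1 / 3) * (μ₁ h + μ₂ h + μ₃ h)) := by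
  have h23 := decAtT_mixture (1 / 2) (by norm_num) (by norm_num) h₂ h₃
  have h123 := decAtT_mixture (1 / 3) (by norm_num) (by norm_num) h₁ h23
  have e : (fun h => (1 / 3 : ℝ) * (μ₁ h + μ₂ h + μ₃ h))
      = (fun h => (1 / 3 : ℝ) * μ₁ h + (1 - 1 / 3) * ((1 / 2 : ℝ) * μ₂ h + (1 - 1 / 2) * μ₃ h)) := by
    funext h
    ring
  rw [e]
  exact h123

/-- **THE THREE-SIBLING GATE STEP FROM THE ORACLE VIA THE BLOCK FAMILY (equal opened means).**  Inside `GateStepN`'s binder: opened trees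
`ρᵢ` tree-built at `x/p` (`nᵢ` gates, tops `Mᵢ ≥ 1`, EQUAL opened means `R₁ = R₂ = R₃`), `n₁+n₂+n₃+3 ≤ n`, a common root gate `x < p < 1`, an
outer gate `0 < a ≤ 1` with `3ap ≤ 2` (write `s = ap`, `r = 3s/2`), and NONNEGATIVE weights `wA wA2 wB wC wP` solving the four root-pattern
equations of `threeRootBlock_mixture`.  Then `gate_a(gate_p ρ₁ ∗ gate_p ρ₂ ∗ gate_p ρ₃)` is DEC(j) at floor `a·x` at every layer
`j < M₁+M₂+M₃`: the components are oracle instances (A, A2, B, C: fewer gates; P: a product of two oracle instances, DEC by `convClosedT_holds`),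
all of mean exactly `3sR₁` and floor `≥ a·x`.  TIED3-G71 §0.4: such weights exist for EVERY `a ≤ min(1, 2/(3p))` (regimes II / IV / III below);
for `p ≤ 2/3` that is every outer gate. [this work] -/
theorem decAt_threeRootBlock_of_oracle (n : ℕ) (x p a wA wA2 wB wC wP : ℝ) (n₁ n₂ n₃ M₁ M₂ M₃ : ℕ) (ρ₁ ρ₂ ρ₃ : ℕ → ℝ)
    (hO : ∀ (x' : ℝ) (n' M' : ℕ) (μ' : ℕ → ℝ), n' < n → TreeBuiltN x' n' M' μ' → SDEC x' M' μ')
    (hn : n₁ + n₂ + n₃ + 3 ≤ n) (hx0 : 0 < x) (hxp : x < p) (hp1 : p < 1)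
    (hM₁ : 0 < M₁) (hM₂ : 0 < M₂) (hM₃ : 0 < M₃)
    (hρ₁ : TreeBuiltN (x / p) n₁ M₁ ρ₁) (hρ₂ : TreeBuiltN (x / p) n₂ M₂ ρ₂) (hρ₃ : TreeBuiltN (x / p) n₃ M₃ ρ₃)
    (hR₁₂ : ∑ h ∈ Finset.range (M₁ + 1), (h : ℝ) * ρ₁ h = ∑ h ∈ Finset.range (M₂ + 1), (h : ℝ) * ρ₂ h)
    (hR₁₃ : ∑ h ∈ Finset.range (M₁ + 1), (h : ℝ) * ρ₁ h = ∑ h ∈ Finset.range (M₃ + 1), (h : ℝ) * ρ₃ h)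
    (ha0 : 0 < a) (ha1 : a ≤ 1) (har : 3 * (a * p) ≤ 2)
    (hwA : 0 ≤ wA) (hwA2 : 0 ≤ wA2) (hwB : 0 ≤ wB) (hwC : 0 ≤ wC) (hwP : 0 ≤ wP)
    (hE0 : 1 - a + a * (1 - p) ^ 3 = wA * (1 - 3 * (a * p) / 2) + wA2 * (1 - 3 * (a * p) / 2) ^ 2 + wB * (1 - a * p)
      + wC * (1 - a * p) ^ 2 + wP * (1 - a * p) ^ 3)
    (hE1 : a * p * (1 - p) ^ 2 = wA2 * (2 / 3) * (3 * (a * p) / 2) * (1 - 3 * (a * p) / 2) + wC * (a * p) * (1 - a * p) / 3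
      + wP * (a * p) * (1 - a * p) ^ 2)
    (hE2 : a * p ^ 2 * (1 - p) = wA * (3 * (a * p) / 2) / 3 + wA2 * (3 * (a * p) / 2) ^ 2 / 3 + wC * (a * p) * (1 - a * p) / 3
      + wP * (a * p) ^ 2 * (1 - a * p))
    (hE3 : a * p ^ 3 = wB * (a * p) + wC * (a * p) ^ 2 + wP * (a * p) ^ 3)
    (j : ℕ) (hj : j < M₁ + M₂ + M₃) :
    DECAt (a * x) j (M₁ + M₂ + M₃) (gate (lconv (M₁ + M₂) M₃ (lconv M₁ M₂ (gate ρ₁ p) (gate ρ₂ p)) (gate ρ₃ p)) a) := by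
  have hw1' : wA + wA2 + wB + wC + wP = 1 := by
    linear_combination (-1 : ℝ) * hE0 - 3 * hE1 - 3 * hE2 - hE3
  -- the opened means and the target
  set R₁ : ℝ := ∑ h ∈ Finset.range (M₁ + 1), (h : ℝ) * ρ₁ h with hR₁
  set R₂ : ℝ := ∑ h ∈ Finset.range (M₂ + 1), (h : ℝ) * ρ₂ h with hR₂
  set R₃ : ℝ := ∑ h ∈ Finset.range (M₃ + 1), (h : ℝ) * ρ₃ h with hR₃
  have hp0 : 0 < p := lt_trans hx0 hxp
  have hy0 : 0 < x / p := div_pos hx0 hp0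
  obtain ⟨_, _, r₁0, r₁M, r₁1, r₁ta⟩ := hρ₁.lawFacts
  obtain ⟨_, _, r₂0, r₂M, r₂1, _⟩ := hρ₂.lawFacts
  obtain ⟨_, _, r₃0, r₃M, r₃1, _⟩ := hρ₃.lawFacts
  have hR₁0 : 0 < R₁ := lt_of_lt_of_le (mul_pos hy0 (by exact_mod_cast hM₁)) r₁ta
  set s : ℝ := a * p with hs
  have hs0 : 0 < s := mul_pos ha0 hp0
  have hs1 : s < 1 := by
    rw [hs]
    exact lt_of_le_of_lt (mul_le_of_le_one_left hp0.le ha1) hp1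
  set r : ℝ := 3 * s / 2 with hr
  have hr0 : 0 < r := by rw [hr]; linarith only [hs0]
  have hr1 : r ≤ 1 := by rw [hr]; linarith only [har]
  have hsr : s ≤ r := by rw [hr]; linarith only [hs0]
  set S : ℝ := 3 * s * R₁ with hS
  have esx : s * (x / p) = a * x := by rw [hs]; field_simp
  have hax_r : a * x ≤ r * (x / p) := by rw [← esx]; exact mul_le_mul_of_nonneg_right hsr hy0.le
  -- sub-forests at floor `x/p` and their laws
  have t₁₂ := TreeBuiltN.conv hρ₁ hρ₂
  have t₁₃ := TreeBuiltN.conv hρ₁ hρ₃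
  have t₂₃ := TreeBuiltN.conv hρ₂ hρ₃
  have t₁₂₃ := TreeBuiltN.conv t₁₂ hρ₃
  obtain ⟨_, _, l₁₂0, l₁₂M, l₁₂1, _⟩ := t₁₂.lawFacts
  obtain ⟨_, _, l₁₃0, l₁₃M, l₁₃1, _⟩ := t₁₃.lawFacts
  obtain ⟨_, _, l₂₃0, l₂₃M, l₂₃1, _⟩ := t₂₃.lawFacts
  -- A components: pair block re-gated to `r`, third tree absent
  obtain ⟨na₁, hna₁, hA₁⟩ := exists_gate_of_treeBuiltN t₂₃ r hr0 hr1
  obtain ⟨na₂, hna₂, hA₂⟩ := exists_gate_of_treeBuiltN t₁₃ r hr0 hr1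
  obtain ⟨na₃, hna₃, hA₃⟩ := exists_gate_of_treeBuiltN t₁₂ r hr0 hr1
  have dA₁ : DECAtT (a * x) S j (M₁ + M₂ + M₃) (gate (lconv M₂ M₃ ρ₂ ρ₃) r) := by
    have d := decAtT_of_oracle n hO hA₁ (by omega) hax_r (M₁ + M₂ + M₃) (by omega) j
    rw [sum_mul_gate, sum_mul_lconv M₂ M₃ ρ₂ ρ₃ r₂1 r₃1, ← hR₂, ← hR₃, ← hR₁₂, ← hR₁₃] at d
    have e : r * (R₁ + R₁) = S := by rw [hS, hr]; ring
    rwa [e] at d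
  have dA₂ : DECAtT (a * x) S j (M₁ + M₂ + M₃) (gate (lconv M₁ M₃ ρ₁ ρ₃) r) := by
    have d := decAtT_of_oracle n hO hA₂ (by omega) hax_r (M₁ + M₂ + M₃) (by omega) j
    rw [sum_mul_gate, sum_mul_lconv M₁ M₃ ρ₁ ρ₃ r₁1 r₃1, ← hR₁, ← hR₃, ← hR₁₃] at d
    have e : r * (R₁ + R₁) = S := by rw [hS, hr]; ring
    rwa [e] at d
  have dA₃ : DECAtT (a * x) S j (M₁ + M₂ + M₃) (gate (lconv M₁ M₂ ρ₁ ρ₂) r) := by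
    have d := decAtT_of_oracle n hO hA₃ (by omega) hax_r (M₁ + M₂ + M₃) (by omega) j
    rw [sum_mul_gate, sum_mul_lconv M₁ M₂ ρ₁ ρ₂ r₁1 r₂1, ← hR₁, ← hR₂, ← hR₁₂] at d
    have e : r * (R₁ + R₁) = S := by rw [hS, hr]; ring
    rwa [e] at d
  -- A2 components: two independently re-gated trees, third absent
  obtain ⟨nq₁, hnq₁, hq₁⟩ := exists_gate_of_treeBuiltN hρ₁ r hr0 hr1
  obtain ⟨nq₂, hnq₂, hq₂⟩ := exists_gate_of_treeBuiltN hρ₂ r hr0 hr1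
  obtain ⟨nq₃, hnq₃, hq₃⟩ := exists_gate_of_treeBuiltN hρ₃ r hr0 hr1
  obtain ⟨_, _, q₁1⟩ := gate_laws M₁ ρ₁ r hr0.le hr1 r₁0 r₁M r₁1
  obtain ⟨_, _, q₂1⟩ := gate_laws M₂ ρ₂ r hr0.le hr1 r₂0 r₂M r₂1
  obtain ⟨_, _, q₃1⟩ := gate_laws M₃ ρ₃ r hr0.le hr1 r₃0 r₃M r₃1
  have dQ₁ : DECAtT (a * x) S j (M₁ + M₂ + M₃) (lconv M₂ M₃ (gate ρ₂ r) (gate ρ₃ r)) := by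
    have d := decAtT_of_oracle n hO (TreeBuiltN.conv hq₂ hq₃) (by omega) hax_r (M₁ + M₂ + M₃) (by omega) j
    rw [sum_mul_lconv M₂ M₃ _ _ q₂1 q₃1, sum_mul_gate, sum_mul_gate, ← hR₂, ← hR₃, ← hR₁₂, ← hR₁₃] at d
    have e : r * R₁ + r * R₁ = S := by rw [hS, hr]; ring
    rwa [e] at d
  have dQ₂ : DECAtT (a * x) S j (M₁ + M₂ + M₃) (lconv M₁ M₃ (gate ρ₁ r) (gate ρ₃ r)) := by
    have d := decAtT_of_oracle n hO (TreeBuiltN.conv hq₁ hq₃) (by omega) hax_r (M₁ + M₂ + M₃) (by omega) j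
    rw [sum_mul_lconv M₁ M₃ _ _ q₁1 q₃1, sum_mul_gate, sum_mul_gate, ← hR₁, ← hR₃, ← hR₁₃] at d
    have e : r * R₁ + r * R₁ = S := by rw [hS, hr]; ring
    rwa [e] at d
  have dQ₃ : DECAtT (a * x) S j (M₁ + M₂ + M₃) (lconv M₁ M₂ (gate ρ₁ r) (gate ρ₂ r)) := by
    have d := decAtT_of_oracle n hO (TreeBuiltN.conv hq₁ hq₂) (by omega) hax_r (M₁ + M₂ + M₃) (by omega) j
    rw [sum_mul_lconv M₁ M₂ _ _ q₁1 q₂1, sum_mul_gate, sum_mul_gate, ← hR₁, ← hR₂, ← hR₁₂] at d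
    have e : r * R₁ + r * R₁ = S := by rw [hS, hr]; ring
    rwa [e] at d
  -- B: all three opened under the gate `s`
  obtain ⟨nB, hnB, hB⟩ := exists_gate_of_treeBuiltN t₁₂₃ s hs0 hs1.le
  have dB : DECAtT (a * x) S j (M₁ + M₂ + M₃) (gate (lconv (M₁ + M₂) M₃ (lconv M₁ M₂ ρ₁ ρ₂) ρ₃) s) := by
    have d := decAtT_of_oracle n hO hB (by omega) (le_of_eq esx.symm) (M₁ + M₂ + M₃) le_rfl j
    rw [sum_mul_gate, sum_mul_lconv (M₁ + M₂) M₃ _ _ l₁₂1 r₃1, sum_mul_lconv M₁ M₂ ρ₁ ρ₂ r₁1 r₂1,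
      ← hR₁, ← hR₂, ← hR₃, ← hR₁₂, ← hR₁₃] at d
    have e : s * (R₁ + R₁ + R₁) = S := by rw [hS]; ring
    rwa [e] at d
  -- C components and the single gated trees
  obtain ⟨nc₁, hnc₁, hc₁⟩ := exists_gate_of_treeBuiltN hρ₁ s hs0 hs1.le
  obtain ⟨nc₂, hnc₂, hc₂⟩ := exists_gate_of_treeBuiltN hρ₂ s hs0 hs1.le
  obtain ⟨nc₃, hnc₃, hc₃⟩ := exists_gate_of_treeBuiltN hρ₃ s hs0 hs1.le
  obtain ⟨nd₁, hnd₁, hd₁⟩ := exists_gate_of_treeBuiltN t₂₃ s hs0 hs1.le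
  obtain ⟨nd₂, hnd₂, hd₂⟩ := exists_gate_of_treeBuiltN t₁₃ s hs0 hs1.le
  obtain ⟨nd₃, hnd₃, hd₃⟩ := exists_gate_of_treeBuiltN t₁₂ s hs0 hs1.le
  obtain ⟨g₁0, g₁M, g₁1⟩ := gate_laws M₁ ρ₁ s hs0.le hs1.le r₁0 r₁M r₁1
  obtain ⟨g₂0, g₂M, g₂1⟩ := gate_laws M₂ ρ₂ s hs0.le hs1.le r₂0 r₂M r₂1
  obtain ⟨g₃0, g₃M, g₃1⟩ := gate_laws M₃ ρ₃ s hs0.le hs1.le r₃0 r₃M r₃1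
  obtain ⟨_, _, e₂₃1⟩ := gate_laws (M₂ + M₃) _ s hs0.le hs1.le l₂₃0 l₂₃M l₂₃1
  obtain ⟨_, _, e₁₃1⟩ := gate_laws (M₁ + M₃) _ s hs0.le hs1.le l₁₃0 l₁₃M l₁₃1
  obtain ⟨_, _, e₁₂1⟩ := gate_laws (M₁ + M₂) _ s hs0.le hs1.le l₁₂0 l₁₂M l₁₂1
  have dC₁ : DECAtT (a * x) S j (M₁ + M₂ + M₃) (lconv M₁ (M₂ + M₃) (gate ρ₁ s) (gate (lconv M₂ M₃ ρ₂ ρ₃) s)) := by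
    have d := decAtT_of_oracle n hO (TreeBuiltN.conv hc₁ hd₁) (by omega) (le_of_eq esx.symm) (M₁ + M₂ + M₃) (by omega) j
    rw [sum_mul_lconv M₁ (M₂ + M₃) _ _ g₁1 e₂₃1, sum_mul_gate, sum_mul_gate, sum_mul_lconv M₂ M₃ ρ₂ ρ₃ r₂1 r₃1,
      ← hR₁, ← hR₂, ← hR₃, ← hR₁₂, ← hR₁₃] at d
    have e : s * R₁ + s * (R₁ + R₁) = S := by rw [hS]; ring
    rwa [e] at d
  have dC₂ : DECAtT (a * x) S j (M₁ + M₂ + M₃) (lconv M₂ (M₁ + M₃) (gate ρ₂ s) (gate (lconv M₁ M₃ ρ₁ ρ₃) s)) := by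
    have d := decAtT_of_oracle n hO (TreeBuiltN.conv hc₂ hd₂) (by omega) (le_of_eq esx.symm) (M₁ + M₂ + M₃) (by omega) j
    rw [sum_mul_lconv M₂ (M₁ + M₃) _ _ g₂1 e₁₃1, sum_mul_gate, sum_mul_gate, sum_mul_lconv M₁ M₃ ρ₁ ρ₃ r₁1 r₃1,
      ← hR₁, ← hR₂, ← hR₃, ← hR₁₂, ← hR₁₃] at d
    have e : s * R₁ + s * (R₁ + R₁) = S := by rw [hS]; ring
    rwa [e] at d
  have dC₃ : DECAtT (a * x) S j (M₁ + M₂ + M₃) (lconv (M₁ + M₂) M₃ (gate (lconv M₁ M₂ ρ₁ ρ₂) s) (gate ρ₃ s)) := by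
    have d := decAtT_of_oracle n hO (TreeBuiltN.conv hd₃ hc₃) (by omega) (le_of_eq esx.symm) (M₁ + M₂ + M₃) le_rfl j
    rw [sum_mul_lconv (M₁ + M₂) M₃ _ _ e₁₂1 g₃1, sum_mul_gate, sum_mul_gate, sum_mul_lconv M₁ M₂ ρ₁ ρ₂ r₁1 r₂1,
      ← hR₁, ← hR₂, ← hR₃, ← hR₁₂, ← hR₁₃] at d
    have e : s * (R₁ + R₁) + s * R₁ = S := by rw [hS]; ring
    rwa [e] at d
  -- P: three independently gated trees — the product of two oracle instances, DEC by `ConvClosedT`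
  have hc₁₂ := TreeBuiltN.conv hc₁ hc₂
  obtain ⟨_, _, f₁₂0, f₁₂M, f₁₂1, _⟩ := hc₁₂.lawFacts
  have hax1 : a * x < 1 := by rw [← esx]; exact lt_of_le_of_lt (mul_le_of_le_one_left hy0.le hs1.le) (by linarith only [hxp, hp1, hx0, (div_lt_one hp0).2 hxp])
  have dP : DECAtT (a * x) S j (M₁ + M₂ + M₃) (lconv (M₁ + M₂) M₃ (lconv M₁ M₂ (gate ρ₁ s) (gate ρ₂ s)) (gate ρ₃ s)) := by
    have d₁₂ : ∀ j'', DECAtT (a * x) (∑ h ∈ Finset.range (M₁ + M₂ + 1), (h : ℝ) * lconv M₁ M₂ (gate ρ₁ s) (gate ρ₂ s) h) j''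
        (M₁ + M₂) (lconv M₁ M₂ (gate ρ₁ s) (gate ρ₂ s)) :=
      fun j'' => decAtT_of_oracle n hO hc₁₂ (by omega) (le_of_eq esx.symm) (M₁ + M₂) le_rfl j''
    have d₃ : ∀ j'', DECAtT (a * x) (∑ h ∈ Finset.range (M₃ + 1), (h : ℝ) * gate ρ₃ s h) j'' M₃ (gate ρ₃ s) :=
      fun j'' => decAtT_of_oracle n hO hc₃ (by omega) (le_of_eq esx.symm) M₃ le_rfl j''
    have d := convClosedT_holds (a * x) _ _ (M₁ + M₂) M₃ j _ _ (mul_pos ha0 hx0) hax1 f₁₂0 f₁₂M f₁₂1 g₃0 g₃M g₃1 hj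
      (fun j'' _ _ => d₁₂ j'') (fun j'' _ _ => d₃ j'')
    rw [sum_mul_lconv M₁ M₂ _ _ g₁1 g₂1, sum_mul_gate, sum_mul_gate, sum_mul_gate, ← hR₁, ← hR₂, ← hR₃, ← hR₁₂, ← hR₁₃] at d
    have e : s * R₁ + s * R₁ + s * R₁ = S := by rw [hS]; ring
    rwa [e] at d
  -- the five-component mixture of the symmetrised families
  have dA := decAtT_avg3 dA₁ dA₂ dA₃
  have dQ := decAtT_avg3 dQ₁ dQ₂ dQ₃
  have dC := decAtT_avg3 dC₁ dC₂ dC₃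
  let w : Fin 5 → ℝ := ![wA, wA2, wB, wC, wP]
  let ν : Fin 5 → ℕ → ℝ :=
    ![fun h => (1 / 3) * (gate (lconv M₂ M₃ ρ₂ ρ₃) r h + gate (lconv M₁ M₃ ρ₁ ρ₃) r h + gate (lconv M₁ M₂ ρ₁ ρ₂) r h),
      fun h => (1 / 3) * (lconv M₂ M₃ (gate ρ₂ r) (gate ρ₃ r) h + lconv M₁ M₃ (gate ρ₁ r) (gate ρ₃ r) h
        + lconv M₁ M₂ (gate ρ₁ r) (gate ρ₂ r) h),
      gate (lconv (M₁ + M₂) M₃ (lconv M₁ M₂ ρ₁ ρ₂) ρ₃) s,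
      fun h => (1 / 3) * (lconv M₁ (M₂ + M₃) (gate ρ₁ s) (gate (lconv M₂ M₃ ρ₂ ρ₃) s) h
        + lconv M₂ (M₁ + M₃) (gate ρ₂ s) (gate (lconv M₁ M₃ ρ₁ ρ₃) s) h
        + lconv (M₁ + M₂) M₃ (gate (lconv M₁ M₂ ρ₁ ρ₂) s) (gate ρ₃ s) h),
      lconv (M₁ + M₂) M₃ (lconv M₁ M₂ (gate ρ₁ s) (gate ρ₂ s)) (gate ρ₃ s)]
  have hw0 : ∀ i, 0 ≤ w i := by
    intro i
    fin_cases i <;> assumption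
  have hw1 : ∑ i, w i = 1 := by
    rw [Fin.sum_univ_five]
    exact hw1'
  have hdec : ∀ i, 0 < w i → DECAtT (a * x) S j (M₁ + M₂ + M₃) (ν i) := by
    intro i _
    fin_cases i <;> assumption
  have hμ : ∀ h, gate (lconv (M₁ + M₂) M₃ (lconv M₁ M₂ (gate ρ₁ p) (gate ρ₂ p)) (gate ρ₃ p)) a h = ∑ i, w i * ν i h := by
    intro h
    rw [Fin.sum_univ_five]
    show _ = wA * ((1 / 3) * (gate (lconv M₂ M₃ ρ₂ ρ₃) r h + gate (lconv M₁ M₃ ρ₁ ρ₃) r h + gate (lconv M₁ M₂ ρ₁ ρ₂) r h))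
        + wA2 * ((1 / 3) * (lconv M₂ M₃ (gate ρ₂ r) (gate ρ₃ r) h + lconv M₁ M₃ (gate ρ₁ r) (gate ρ₃ r) h
            + lconv M₁ M₂ (gate ρ₁ r) (gate ρ₂ r) h))
        + wB * gate (lconv (M₁ + M₂) M₃ (lconv M₁ M₂ ρ₁ ρ₂) ρ₃) s h
        + wC * ((1 / 3) * (lconv M₁ (M₂ + M₃) (gate ρ₁ s) (gate (lconv M₂ M₃ ρ₂ ρ₃) s) h
            + lconv M₂ (M₁ + M₃) (gate ρ₂ s) (gate (lconv M₁ M₃ ρ₁ ρ₃) s) h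
            + lconv (M₁ + M₂) M₃ (gate (lconv M₁ M₂ ρ₁ ρ₂) s) (gate ρ₃ s) h))
        + wP * lconv (M₁ + M₂) M₃ (lconv M₁ M₂ (gate ρ₁ s) (gate ρ₂ s)) (gate ρ₃ s) h
    exact threeRootBlock_mixture M₁ M₂ M₃ ρ₁ ρ₂ ρ₃ p a s r wA wA2 wB wC wP r₁M r₂M r₃M hE0 hE1 hE2 hE3 h
  -- the mean of the doubly gated law is the target
  obtain ⟨_, _, t₁1⟩ := gate_laws M₁ ρ₁ p hp0.le hp1.le r₁0 r₁M r₁1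
  obtain ⟨_, _, t₂1⟩ := gate_laws M₂ ρ₂ p hp0.le hp1.le r₂0 r₂M r₂1
  obtain ⟨_, _, t₃1⟩ := gate_laws M₃ ρ₃ p hp0.le hp1.le r₃0 r₃M r₃1
  obtain ⟨_, _, _, _, t₁₂1, _⟩ := (TreeBuiltN.conv (TreeBuiltN.gate p hp0 hp1 hρ₁) (TreeBuiltN.gate p hp0 hp1 hρ₂)).lawFacts
  have hmean : ∑ h ∈ Finset.range (M₁ + M₂ + M₃ + 1),
      (h : ℝ) * gate (lconv (M₁ + M₂) M₃ (lconv M₁ M₂ (gate ρ₁ p) (gate ρ₂ p)) (gate ρ₃ p)) a h = S := by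
    rw [sum_mul_gate, sum_mul_lconv (M₁ + M₂) M₃ _ _ t₁₂1 t₃1, sum_mul_lconv M₁ M₂ _ _ t₁1 t₂1, sum_mul_gate, sum_mul_gate,
      sum_mul_gate, ← hR₁, ← hR₂, ← hR₃, ← hR₁₂, ← hR₁₃, hS, hs]
    ring
  rw [decAt_iff_decAtT, hmean]
  exact decAtT_finite_mixture (a * x) S j (M₁ + M₂ + M₃) _ w ν hw0 hw1 hμ hdec

end LawDec

end Quant

end Summit.CriticalPhenomena.PercolationContinuityZ3.Theorems
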